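import Mathlib
import HarnessLib
import Literature.AlgebraicGeometry.HyperbolicPolynomials.SpectrahedralShadow
import Summits.ValiantsHypothesis.ValiantsHypothesis.Theorems.PermanentalConesHyperbolicVPShadowStubConeOfConjPreimage
import Summits.ValiantsHypothesis.ValiantsHypothesis.Theorems.PermanentalConesHyperbolicVPShadowStubOshimeFamily1hSpectrahedron
import Summits.ValiantsHypothesis.ValiantsHypothesis.Theorems.PermanentalConesHyperbolicVPShadowStubOshimeFamily2hSpectrahedron
import Summits.ValiantsHypothesis.ValiantsHypothesis.Theorems.PermanentalConesHyperbolicVPShadowStubOshimeFamilyIhSpectrahedron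
import Summits.ValiantsHypothesis.ValiantsHypothesis.Theorems.PermanentalConesHyperbolicVPShadowStubOshimeFamilyTleSpectrahedron
import Summits.ValiantsHypothesis.ValiantsHypothesis.Theorems.PermanentalConesHyperbolicVPShadowStubOshimeFamilyD3hSpectrahedron
import Summits.ValiantsHypothesis.ValiantsHypothesis.Theorems.PermanentalConesHyperbolicVPShadowStubOshimeFamilyD4hSpectrahedron
import Summits.ValiantsHypothesis.ValiantsHypothesis.Theorems.PermanentalConesHyperbolicVPShadowStubOshimeFamilyD5hSpectrahedron

/-!
# ValiantsHypothesis / PermanentalCones — `HyperbolicVPShadow`, stub N₃ (the `N = 3` assembly)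

Route `PermanentalCones`, item `stmt-ValiantsHypothesis-8655` (crux `HyperbolicVPShadow`), line
`birth`, stub `stub_highEff_N3_of_oshimeClassification`.

The open stub H of this crux asks, for linear pencils `P : ℝⁿ →ₗ Mat_N(ℝ)` with only real
eigenvalues that are irreducible, not simultaneously symmetrisable and span (together with `1`) a
space of dimension `≥ 4`, for small lifted-LMI descriptions of the closed nonnegative-spectrum cone
`{x : ∀ τ > 0, det (P x + τ·1) ≠ 0}`. At `N = 3`, T. Oshime (*Linear pencils of real matrices
with only real eigenvalues (I), (II)*, J. Math. Kyoto Univ. **31** (1991), 937–982 and 983–1021;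
(I) Thm 4.7 with Prop 4.6 and Thm 5.1, (II) Thms 6.1–6.3) classified such pencils up to
equivalence (`P x = T · G (M x) · T⁻¹` or `P x = T · (G (M x))ᵀ · T⁻¹`, `T` invertible, `M`
linear) into seven canonical families (1), (2), (I), (T), (D3), (D4), (D5).

This file contains **no new mathematics**: it assembles

* the seven landed certificates `stub_oshimeFamily1h_spectrahedron` (size `3`),
  `stub_oshimeFamily2h_spectrahedron` (size `6`), `stub_oshimeFamilyIh_spectrahedron` (size `6`),
  `stub_oshimeFamilyTle_spectrahedron` (size `3`), `stub_oshimeFamilyD3h_spectrahedron`,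
  `stub_oshimeFamilyD4h_spectrahedron`, `stub_oshimeFamilyD5h_spectrahedron` (size `6` each) —
  lifted-LMI descriptions of the cones of the seven *homogenised* canonical families — and
* the landed bookkeeping lemma `stub_cone_of_conjPreimage` (the cone of a pencil equivalent to `G`
  is the linear preimage of the cone of `G`; sizes may be padded),

into the statement: **if** every pencil as above is equivalent to a member of one of the seven
homogenised families (the first hypothesis — an explicit *rendering* of Oshime's printed
classification theorems, taken as a hypothesis and **not** vendored here), **then** the cone of
every such pencil is a lifted-LMI set of the absolute size `6`. The proof is a seven-way case
analysis.
-/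

-- `<Problem> = <Summit>` for this single-conjunct summit (lakefile sets the same option tree-wide).
set_option linter.dupNamespace false

namespace Summit.ValiantsHypothesis.ValiantsHypothesis.Theorems

open Matrix
open Literature.AlgebraicGeometry.HyperbolicPolynomials

/-- **Stub N₃ (the `N = 3` assembly modulo Oshime's classification).** *If* every linear pencil
`P : ℝⁿ →ₗ Mat₃(ℝ)` with only real eigenvalues that is irreducible (no nontrivial common invariant
subspace), not simultaneously symmetrisable (no positive definite `S` with all `S · P x`
symmetric) and spans together with `1` a space of dimension `≥ 4` is equivalent —
`P x = T · G (M x) · T⁻¹` for all `x`, or `P x = T · (G (M x))ᵀ · T⁻¹` for all `x`, with `T`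
invertible and `M : ℝⁿ →ₗ ℝ⁴` linear — to a member `G y = y₀ 1 + y₁ A + y₂ B + y₃ C` of one of the
seven homogenised canonical families (1), (2), (I), (T), (D3), (D4), (D5), *then* the closed
nonnegative-spectrum cone `{x : ∀ τ > 0, det (P x + τ·1) ≠ 0}` of every such pencil is a
lifted-LMI set of size `6`.

The first hypothesis is the lead's explicit RENDERING of the printed classification theorems of
T. Oshime, *Linear pencils of real matrices with only real eigenvalues*, part (I) — Thm 4.7 with
Prop 4.6 (dimension `4`) and Thm 5.1 (dimension `≥ 5` does not occur) — and part (II) —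
Thms 6.1–6.3 —, J. Math. Kyoto Univ. **31** (1991), 937–982 and 983–1021; it is a hypothesis of
this theorem, not a vendored fact. The proof is bookkeeping: a seven-way case analysis calling
the landed certificates `stub_oshimeFamily{1h,2h,Ih,Tle,D3h,D4h,D5h}_spectrahedron` for the
canonical families and `stub_cone_of_conjPreimage` to transport (and pad to size `6`) the
description along the equivalence. [folklore] -/
theorem stub_highEff_N3_of_oshimeClassification :
    (∀ (n : ℕ) (P : (Fin n → ℝ) →ₗ[ℝ] Matrix (Fin 3) (Fin 3) ℝ),
      (∀ (x : Fin n → ℝ) (z : ℂ),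
        ((P x).map (algebraMap ℝ ℂ) - z • (1 : Matrix (Fin 3) (Fin 3) ℂ)).det = 0 → z.im = 0) →
      (∀ W : Submodule ℝ (Fin 3 → ℝ), (∀ (x : Fin n → ℝ), ∀ v ∈ W, Matrix.mulVec (P x) v ∈ W) →
        W = ⊥ ∨ W = ⊤) →
      (¬ ∃ S : Matrix (Fin 3) (Fin 3) ℝ, S.PosDef ∧ ∀ x : Fin n → ℝ, (S * P x).IsSymm) →
      3 < Module.finrank ℝ (Submodule.span ℝ
        (insert (1 : Matrix (Fin 3) (Fin 3) ℝ) (Set.range P))) →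
      ∃ (T : Matrix (Fin 3) (Fin 3) ℝ) (M : (Fin n → ℝ) →ₗ[ℝ] (Fin 4 → ℝ))
        (G : (Fin 4 → ℝ) →ₗ[ℝ] Matrix (Fin 3) (Fin 3) ℝ), IsUnit T ∧
        ((∀ x, P x = T * G (M x) * T⁻¹) ∨ (∀ x, P x = T * (G (M x)).transpose * T⁻¹)) ∧
        ((∃ a : ℝ, a ^ 2 ≤ 1 ∧
            ∀ y : Fin 4 → ℝ, G y = y 0 • (1 : Matrix (Fin 3) (Fin 3) ℝ) + y 1 • !![(1 : ℝ), 0, 0; 0, 0, 0; 0, 0, 0] +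
              y 2 • !![(0 : ℝ), 1, 0; 1, 0, 0; 0, 0, 0] + y 3 • !![(0 : ℝ), a, 1; -a, 0, 0; 1, 0, 0]) ∨
          (∃ α β β' γ γ' : ℝ, 0 < α ∧ 0 < 2 * α * γ - α ^ 2 - β ^ 2 ∧ 0 < 2 * α * γ' - α ^ 2 - β' ^ 2 ∧
            ∀ y : Fin 4 → ℝ, G y = y 0 • (1 : Matrix (Fin 3) (Fin 3) ℝ) + y 1 • !![(1 : ℝ), 0, 0; 0, 0, 0; 0, 0, 0] +
              y 2 • !![0, α, 0; α, 1, 0; 0, 0, -1] + y 3 • !![0, β, γ; β', 0, 1; γ', 1, 0]) ∨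
          (∃ a β γ : ℝ, 0 ≤ a ∧ a ≤ 1 ∧ β ^ 2 ≤ 8 * γ ∧
            ∀ y : Fin 4 → ℝ, G y = y 0 • (1 : Matrix (Fin 3) (Fin 3) ℝ) + y 1 • !![(1 : ℝ), 0, 0; 0, 0, 0; 0, 0, 0] +
              y 2 • !![(0 : ℝ), 1, 0; 1, 0, 1; 0, 0, 0] + y 3 • !![0, β, -γ; β * (1 - a), 1, 0; -2 * a, 0, -1]) ∨
          (∃ s₁ s₂ s₃ b₀ b₁ b₂ : ℝ, s₁ ≤ s₂ ∧ s₂ ≤ s₃ ∧ s₁ ≤ b₁ ∧ b₁ ≤ s₂ ∧ s₂ ≤ b₂ ∧ b₂ ≤ s₃ ∧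
            ∀ y : Fin 4 → ℝ, G y = y 0 • (1 : Matrix (Fin 3) (Fin 3) ℝ) + y 1 • !![(0 : ℝ), 1, 0; 0, 0, 1; 0, 0, 0] +
              y 2 • !![0, s₁ * s₂ + s₂ * s₃ + s₃ * s₁, -(s₁ * s₂ * s₃); -1, s₁ + s₂ + s₃, 0; 0, 1, 0] + y 3 • !![0, b₀ * (b₁ + b₂), -(b₀ * b₁ * b₂); 0, b₀, 0; 0, 0, 0]) ∨
          (∃ a γ δ : ℝ, 1 ≤ 2 * a ∧ 0 ≤ 1 + 2 * γ ∧ δ ^ 2 ≤ (2 * a - 1) * (1 + 2 * γ) ∧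
            ∀ y : Fin 4 → ℝ, G y = y 0 • (1 : Matrix (Fin 3) (Fin 3) ℝ) + y 1 • !![(1 : ℝ), 0, 0; 0, 0, 1; 0, 0, 0] +
              y 2 • !![2 * a - 1, 1, -a; a, 0, 0; -1, 0, 0] + y 3 • !![2 * δ, 1, γ - δ; γ + δ, 1, 0; 1, 0, -1]) ∨
          (∃ a ρ σ : ℝ, 1 ≤ 2 * a ∧ ρ ^ 2 + σ ^ 2 ≤ (2 * a - 1) ^ 2 ∧
            ∀ y : Fin 4 → ℝ, G y = y 0 • (1 : Matrix (Fin 3) (Fin 3) ℝ) + y 1 • !![(1 : ℝ), 0, 0; 0, 0, 1; 0, 0, 0] +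
              y 2 • !![ρ, 1, -a; a, 0, 0; -1, 0, 0] + y 3 • !![σ, 0, 0; 0, 1, 0; 0, 0, -1]) ∨
          (∃ a b γ δ : ℝ, 0 < b ∧ b < 1 ∧ 0 ≤ a * b + γ ∧
            (γ + (1 - a) * b) ^ 2 + b ^ 2 * δ ^ 2 ≤ b ^ 2 * (a * b + γ) ^ 2 ∧
            ∀ y : Fin 4 → ℝ, G y = y 0 • (1 : Matrix (Fin 3) (Fin 3) ℝ) + y 1 • !![(1 : ℝ), 0, 0; 0, 0, 1; 0, 0, 0] +
              y 2 • !![(1 - 1 / b ^ 2) * γ + a * b + (a - 1) / b, 1, -a; a, 0, 0; -1, 0, 0] + y 3 • !![(b + 1 / b) * δ, b, γ - δ; γ + δ, 1, 0; b, 0, -1]))) →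
    ∀ (n : ℕ) (P : (Fin n → ℝ) →ₗ[ℝ] Matrix (Fin 3) (Fin 3) ℝ),
      (∀ (x : Fin n → ℝ) (z : ℂ),
        ((P x).map (algebraMap ℝ ℂ) - z • (1 : Matrix (Fin 3) (Fin 3) ℂ)).det = 0 → z.im = 0) →
      (∀ W : Submodule ℝ (Fin 3 → ℝ), (∀ (x : Fin n → ℝ), ∀ v ∈ W, Matrix.mulVec (P x) v ∈ W) →
        W = ⊥ ∨ W = ⊤) →
      (¬ ∃ S : Matrix (Fin 3) (Fin 3) ℝ, S.PosDef ∧ ∀ x : Fin n → ℝ, (S * P x).IsSymm) →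
      3 < Module.finrank ℝ (Submodule.span ℝ
        (insert (1 : Matrix (Fin 3) (Fin 3) ℝ) (Set.range P))) →
      Literature.AlgebraicGeometry.HyperbolicPolynomials.IsSpectrahedralShadowOfSize
        {x : Fin n → ℝ | ∀ τ : ℝ, 0 < τ → (P x + τ • (1 : Matrix (Fin 3) (Fin 3) ℝ)).det ≠ 0} 6 := by
  intro hO n P hRS hirr hns hdim
  obtain ⟨T, M, G, hT, hPG, hfam⟩ := hO n P hRS hirr hns hdim
  -- transport along the equivalence and pad: a size-`s ≤ 6` description of the cone of `G`
  -- gives a size-`6` description of the cone of `P`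
  have key : ∀ s : ℕ, s ≤ 6 →
      IsSpectrahedralShadowOfSize
        {y : Fin 4 → ℝ | ∀ τ : ℝ, 0 < τ → (G y + τ • (1 : Matrix (Fin 3) (Fin 3) ℝ)).det ≠ 0} s →
      IsSpectrahedralShadowOfSize
        {x : Fin n → ℝ | ∀ τ : ℝ, 0 < τ → (P x + τ • (1 : Matrix (Fin 3) (Fin 3) ℝ)).det ≠ 0} 6 :=
    fun s hs h => stub_cone_of_conjPreimage n 4 3 s 6 P G M T hT hPG hs h
  rcases hfam with ⟨a, ha, hG⟩ | ⟨α, β, β', γ, γ', hα, hD, hD', hG⟩ | ⟨a, β, γ, ha0, ha1, hβ, hG⟩ |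
      ⟨s₁, s₂, s₃, b₀, b₁, b₂, h12, h23, hb1, hb1', hb2, hb2', hG⟩ | ⟨a, γ, δ, h2a, hγ, hδ, hG⟩ |
      ⟨a, ρ, σ, h2a, hρσ, hG⟩ | ⟨a, b, γ, δ, hb0, hb1, habγ, hineq, hG⟩
  · -- family (1): size `3`
    refine key 3 (by norm_num) ?_
    simp only [hG]
    exact stub_oshimeFamily1h_spectrahedron a ha
  · -- family (2): size `6`
    refine key 6 le_rfl ?_
    simp only [hG]
    exact stub_oshimeFamily2h_spectrahedron α β β' γ γ' hα hD hD'
  · -- family (I): size `6`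
    refine key 6 le_rfl ?_
    simp only [hG]
    exact stub_oshimeFamilyIh_spectrahedron a β γ ha0 ha1 hβ
  · -- family (T) (with interlacing, closure of the parameter region): size `3`
    refine key 3 (by norm_num) ?_
    simp only [hG]
    exact stub_oshimeFamilyTle_spectrahedron s₁ s₂ s₃ b₀ b₁ b₂ h12 h23 hb1 hb1' hb2 hb2'
  · -- family (D3): size `6`
    refine key 6 le_rfl ?_
    simp only [hG]
    exact stub_oshimeFamilyD3h_spectrahedron a γ δ h2a hγ hδ
  · -- family (D4): size `6`
    refine key 6 le_rfl ?_
    simp only [hG]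
    exact stub_oshimeFamilyD4h_spectrahedron a ρ σ h2a hρσ
  · -- family (D5): size `6`
    refine key 6 le_rfl ?_
    simp only [hG]
    exact stub_oshimeFamilyD5h_spectrahedron a b γ δ hb0 hb1 habγ hineq

end Summit.ValiantsHypothesis.ValiantsHypothesis.Theorems
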